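import Literature.Analysis.FluidPDE.WeakSolutionTimeIntegrated
import Literature.Analysis.FluidPDE.PressureReconstruction
import Literature.Analysis.FunctionSpaces.DominatedIteratedDeriv
import Literature.Analysis.FluidPDE.VorticityStretching
import Literature.Analysis.FluidPDE.PolygonCirculation
import Literature.Analysis.FluidPDE.KNSSMildRegularityTime
import Literature.Analysis.FluidPDE.KNSSRegularityWindowOfProp41
import Literature.Analysis.FluidPDE.KNSSRegularityPlanarOfSpace
import Literature.Analysis.FluidPDE.NSBoundedMildOseenClassical
import HarnessLib

/-!
# Bounded weak solutions with smooth slices: the increment minus the time-integrated right-hand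
# side is curl free

Analysis/FluidPDE proofs file, sequel of `WeakSolutionTimeIntegrated` (Koch–Nadirashvili–Seregin–
Šverák, Acta Math. 203 (2009) = arXiv:0709.3599v1, §4 p. 8: "(4.8) … is satisfied in the sense of
distributions"). Let `u` be a bounded weak Navier–Stokes solution on `(a, T) × E` (solenoidal
space–time tests) with `C^∞` slices, all `x`-derivatives bounded on the window, and
`(t, x) ↦ Dᵏu(t)(x)` jointly continuous for every `k`. Then for `a < s ≤ t < T` the smooth field

  `g = u(t) − u(s) − ∫ₛᵗ (νΔu(τ) − Du(τ)[u(τ)]) dτ`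

has a **symmetric derivative** at every point, `⟪Dg(x)v, w⟫ = ⟪Dg(x)w, v⟫`
(`IsBoundedWeakNSSolutionOn.inner_fderiv_increment_comm`): `g` is orthogonal to the solenoidal
tests (previous file), smooth (dominated differentiation of the time integral,
`contDiff_integral_of_dominated_iteratedFDeriv`), hence a gradient (de Rham,
`inner_fderiv_comm_of_forall_integral_inner_eq_zero`). Taking the curl (`n = 3`) or the scalar
vorticity (`n = 2`) gives the time-integrated vorticity equations of KNSS §4–§5 for such fields;
no time derivative of `u` is involved.

Also proved here: sup bounds for the iterated derivatives of `Δf` and of `y ↦ Df(y)[f(y)]` in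
terms of those of `f`.

## References

* G. Koch, N. Nadirashvili, G. Seregin, V. Šverák, Acta Math. 203 (2009) = arXiv:0709.3599v1,
  §4 p. 8 ((4.8)–(4.11)), §5 p. 9 (proof of Thm 5.1). [KochNadirashviliSereginSverak2009]
-/

noncomputable section

open MeasureTheory TopologicalSpace Set Function Filter Metric InnerProductSpace intervalIntegral
open _root_.Topology
open scoped ENNReal NNReal Laplacian RealInnerProductSpace ContDiff

namespace Literature.Analysis.FluidPDE

variable {E : Type*} [NormedAddCommGroup E] [InnerProductSpace ℝ E] [FiniteDimensional ℝ E]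
  [MeasurableSpace E] [BorelSpace E]
variable {F : Type*} [NormedAddCommGroup F] [NormedSpace ℝ F]

/-! ### Sup bounds for iterated derivatives of `Δf` and of `Df[f]` -/

omit [FiniteDimensional ℝ E] [MeasurableSpace E] [BorelSpace E] in
/-- `‖Dᵏ(y ↦ G(y) e)(x)‖ ≤ ‖e‖ ‖DᵏG(x)‖` for an operator-valued `G`. [folklore] -/
theorem norm_iteratedFDeriv_clm_apply_const_le {G : E → E →L[ℝ] F} {n : WithTop ℕ∞}
    (hG : ContDiff ℝ n G) (e : E) {k : ℕ} (hk : (k : WithTop ℕ∞) ≤ n) (x : E) :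
    ‖iteratedFDeriv ℝ k (fun y => G y e) x‖ ≤ ‖e‖ * ‖iteratedFDeriv ℝ k G x‖ := by
  have h := (ContinuousLinearMap.apply ℝ F e).norm_iteratedFDeriv_comp_left (f := G) (x := x)
    hG.contDiffAt hk
  have hnorm : ‖ContinuousLinearMap.apply ℝ F e‖ ≤ ‖e‖ :=
    ContinuousLinearMap.opNorm_le_bound _ (norm_nonneg _) fun L => by
      rw [ContinuousLinearMap.apply_apply, mul_comm]; exact L.le_opNorm e
  exact h.trans (mul_le_mul_of_nonneg_right hnorm (norm_nonneg _))

omit [MeasurableSpace E] [BorelSpace E] in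
/-- **Iterated derivatives of the Laplacian**: `‖Dᵏ(Δf)(x)‖ ≤ (dim E) ‖Dᵏ⁺²f(x)‖` for smooth `f`
(frame expansion `Δf = Σᵢ ∂ᵢ∂ᵢf`). [folklore] -/
theorem norm_iteratedFDeriv_laplacian_le {f : E → F} (hf : ContDiff ℝ ∞ f) (k : ℕ) (x : E) :
    ‖iteratedFDeriv ℝ k (Δ f) x‖ ≤ Module.finrank ℝ E * ‖iteratedFDeriv ℝ (k + 2) f x‖ := by
  set b := stdOrthonormalBasis ℝ E with hb
  -- `Δ f = Σᵢ gᵢ`, `gᵢ = ∂ᵢ(∂ᵢ f)`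
  have hkᵢ : ∀ i, ContDiff ℝ ∞ fun y => fderiv ℝ f y (b i) := fun i =>
    (hf.fderiv_right (m := ∞) (by exact_mod_cast le_rfl)).clm_apply contDiff_const
  have hgᵢ : ∀ i, ContDiff ℝ ∞ fun y => fderiv ℝ (fun z => fderiv ℝ f z (b i)) y (b i) := fun i =>
    ((hkᵢ i).fderiv_right (m := ∞) (by exact_mod_cast le_rfl)).clm_apply contDiff_const
  have hΔ : Δ f = fun y => ∑ i, fderiv ℝ (fun z => fderiv ℝ f z (b i)) y (b i) := by
    rw [laplacian_eq_iteratedFDeriv_orthonormalBasis f b]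
    funext y
    exact Finset.sum_congr rfl fun i _ => iteratedFDeriv_two_apply_self (contDiff_infty.1 hf 2) y (b i)
  rw [hΔ, iteratedFDeriv_fun_sum_apply fun i _ => (hgᵢ i).contDiffAt.of_le (by exact_mod_cast le_top)]
  calc ‖∑ i, iteratedFDeriv ℝ k (fun y => fderiv ℝ (fun z => fderiv ℝ f z (b i)) y (b i)) x‖
      ≤ ∑ i, ‖iteratedFDeriv ℝ k (fun y => fderiv ℝ (fun z => fderiv ℝ f z (b i)) y (b i)) x‖ :=
        norm_sum_le _ _
    _ ≤ ∑ _i : Fin (Module.finrank ℝ E), ‖iteratedFDeriv ℝ (k + 2) f x‖ :=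
        Finset.sum_le_sum fun i _ => by
          have h1 := norm_iteratedFDeriv_clm_apply_const_le
            ((hkᵢ i).fderiv_right (m := ∞) (by exact_mod_cast le_rfl)) (b i) (k := k)
            (by exact_mod_cast le_top) x
          rw [b.orthonormal.1 i, one_mul, norm_iteratedFDeriv_fderiv] at h1
          have h2 := norm_iteratedFDeriv_clm_apply_const_le
            (hf.fderiv_right (m := ∞) (by exact_mod_cast le_rfl)) (b i) (k := k + 1)
            (by exact_mod_cast le_top) x
          rw [b.orthonormal.1 i, one_mul, norm_iteratedFDeriv_fderiv] at h2
          exact h1.trans h2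
    _ = Module.finrank ℝ E * ‖iteratedFDeriv ℝ (k + 2) f x‖ := by simp

omit [FiniteDimensional ℝ E] [MeasurableSpace E] [BorelSpace E] in
/-- **Iterated derivatives of the convective term** `y ↦ Df(y)[f(y)]`:
`‖Dᵏ(Df[f])(x)‖ ≤ Σ_{i ≤ k} C(k, i) ‖Dⁱ⁺¹f(x)‖ ‖Dᵏ⁻ⁱf(x)‖` (Leibniz for the bilinear evaluation).
[folklore] -/
theorem norm_iteratedFDeriv_fderiv_apply_self_le {f : E → E} (hf : ContDiff ℝ ∞ f) (k : ℕ) (x : E) :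
    ‖iteratedFDeriv ℝ k (fun y => fderiv ℝ f y (f y)) x‖ ≤
      ∑ i ∈ Finset.range (k + 1),
        (k.choose i : ℝ) * ‖iteratedFDeriv ℝ (i + 1) f x‖ * ‖iteratedFDeriv ℝ (k - i) f x‖ := by
  -- the evaluation pairing `B L v = L v` is the identity of `E →L[ℝ] E`, read as a bilinear map
  have hBn : ‖ContinuousLinearMap.id ℝ (E →L[ℝ] E)‖ ≤ 1 := ContinuousLinearMap.norm_id_le
  have hDf : ContDiff ℝ ∞ (fderiv ℝ f) := hf.fderiv_right (m := ∞) (by exact_mod_cast le_rfl)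
  have h := (ContinuousLinearMap.id ℝ (E →L[ℝ] E)).norm_iteratedFDeriv_le_of_bilinear hDf hf x
    (n := k) (by exact_mod_cast le_top)
  have heq : (fun y => (ContinuousLinearMap.id ℝ (E →L[ℝ] E)) (fderiv ℝ f y) (f y)) =
      fun y => fderiv ℝ f y (f y) := by
    funext y; rfl
  rw [heq] at h
  refine h.trans ?_
  have hS : 0 ≤ ∑ i ∈ Finset.range (k + 1),
      (k.choose i : ℝ) * ‖iteratedFDeriv ℝ i (fderiv ℝ f) x‖ * ‖iteratedFDeriv ℝ (k - i) f x‖ :=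
    Finset.sum_nonneg fun i _ => by positivity
  calc ‖ContinuousLinearMap.id ℝ (E →L[ℝ] E)‖ * ∑ i ∈ Finset.range (k + 1),
        (k.choose i : ℝ) * ‖iteratedFDeriv ℝ i (fderiv ℝ f) x‖ * ‖iteratedFDeriv ℝ (k - i) f x‖
      ≤ 1 * ∑ i ∈ Finset.range (k + 1),
        (k.choose i : ℝ) * ‖iteratedFDeriv ℝ i (fderiv ℝ f) x‖ * ‖iteratedFDeriv ℝ (k - i) f x‖ :=
        mul_le_mul_of_nonneg_right hBn hS
    _ = _ := by
        rw [one_mul]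
        exact Finset.sum_congr rfl fun i _ => by rw [norm_iteratedFDeriv_fderiv]

/-! ### From joint continuity of all derivatives to the hypotheses of the previous file -/

omit [FiniteDimensional ℝ E] [MeasurableSpace E] [BorelSpace E] in
/-- Joint continuity of `u` from that of `D⁰u`. [folklore] -/
theorem continuousOn_uncurry_of_iteratedFDeriv_zero {S : Set (ℝ × E)} {u : ℝ → E → F}
    (h : ContinuousOn (fun p : ℝ × E => iteratedFDeriv ℝ 0 (u p.1) p.2) S) :
    ContinuousOn (uncurry u) S := by
  have he : uncurry u = fun p : ℝ × E =>
      (continuousMultilinearCurryFin0 ℝ E F) (iteratedFDeriv ℝ 0 (u p.1) p.2) := by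
    funext ⟨τ, y⟩
    simp
  rw [he]
  exact (continuousMultilinearCurryFin0 ℝ E F).continuous.comp_continuousOn h

omit [FiniteDimensional ℝ E] [MeasurableSpace E] [BorelSpace E] in
/-- Joint continuity of `Du` from that of `D¹u`. [folklore] -/
theorem continuousOn_fderiv_of_iteratedFDeriv_one {S : Set (ℝ × E)} {u : ℝ → E → F}
    (h : ContinuousOn (fun p : ℝ × E => iteratedFDeriv ℝ 1 (u p.1) p.2) S) :
    ContinuousOn (fun p : ℝ × E => fderiv ℝ (u p.1) p.2) S := by
  have he : (fun p : ℝ × E => fderiv ℝ (u p.1) p.2) = fun p : ℝ × E =>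
      (continuousMultilinearCurryFin1 ℝ E F) (iteratedFDeriv ℝ 1 (u p.1) p.2) := by
    funext p
    ext v
    simp
  rw [he]
  exact (continuousMultilinearCurryFin1 ℝ E F).continuous.comp_continuousOn h

omit [MeasurableSpace E] [BorelSpace E] in
/-- Joint continuity of `Δu` from that of `D²u` (frame expansion). [folklore] -/
theorem continuousOn_laplacian_of_iteratedFDeriv_two {S : Set (ℝ × E)} {u : ℝ → E → F}
    (h : ContinuousOn (fun p : ℝ × E => iteratedFDeriv ℝ 2 (u p.1) p.2) S) :
    ContinuousOn (fun p : ℝ × E => (Δ (u p.1)) p.2) S := by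
  set b := stdOrthonormalBasis ℝ E with hb
  have he : (fun p : ℝ × E => (Δ (u p.1)) p.2) = fun p : ℝ × E =>
      ∑ i, iteratedFDeriv ℝ 2 (u p.1) p.2 ![b i, b i] := by
    funext p
    rw [laplacian_eq_iteratedFDeriv_orthonormalBasis (u p.1) b]
  rw [he]
  refine continuousOn_finsetSum _ fun i _ => ?_
  exact (ContinuousMultilinearMap.apply ℝ (fun _ : Fin 2 => E) F ![b i, b i]).continuous.comp_continuousOn h

/-! ### Regularity of the time-integrated right-hand side -/

section Rhs

variable {a T ν : ℝ} {u : ℝ → E → E}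

/-- **The time-integrated right-hand side `y ↦ ∫ₛᵗ (νΔu(τ) − Du(τ)[u(τ)])(y) dτ` is smooth, and
its derivative is the time integral of the derivatives** (dominated differentiation of all
orders, `contDiff_integral_of_dominated_iteratedFDeriv`), for a family with `C^∞` slices, all
`x`-derivatives bounded on `(a, T)` and jointly continuous there. [folklore] -/
theorem contDiff_integral_rhs_and_fderiv (hsm : ∀ t ∈ Ioo a T, ContDiff ℝ ∞ (u t))
    (hbd : ∀ k : ℕ, ∃ C : ℝ, ∀ t ∈ Ioo a T, ∀ x, ‖iteratedFDeriv ℝ k (u t) x‖ ≤ C)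
    (hjc : ∀ k : ℕ, ContinuousOn (fun p : ℝ × E => iteratedFDeriv ℝ k (u p.1) p.2) (Ioo a T ×ˢ univ))
    {s t : ℝ} (hs : a < s) (hst : s ≤ t) (ht : t < T) :
    ContDiff ℝ ∞ (fun y => ∫ τ in s..t, (ν • (Δ (u τ)) y - fderiv ℝ (u τ) y (u τ y))) ∧
      (∀ x, fderiv ℝ (fun y => ∫ τ in s..t, (ν • (Δ (u τ)) y - fderiv ℝ (u τ) y (u τ y))) x =
        ∫ τ in s..t, fderiv ℝ (fun y => ν • (Δ (u τ)) y - fderiv ℝ (u τ) y (u τ y)) x) ∧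
      ∀ x, IntervalIntegrable
        (fun τ => fderiv ℝ (fun y => ν • (Δ (u τ)) y - fderiv ℝ (u τ) y (u τ y)) x) volume s t := by
  haveI : CompleteSpace E := FiniteDimensional.complete ℝ E
  set J : Set ℝ := Ioo a T with hJ
  have hJo : IsOpen J := isOpen_Ioo
  have hsJ : s ∈ J := ⟨hs, hst.trans_lt ht⟩
  have hIJ : Icc s t ⊆ J := fun τ hτ => ⟨hs.trans_le hτ.1, hτ.2.trans_lt ht⟩
  choose C hC using hbd
  have hC0 : ∀ k, 0 ≤ C k := fun k => (norm_nonneg _).trans (hC k s hsJ 0)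
  have hc0 : ContinuousOn (uncurry u) (J ×ˢ univ) := continuousOn_uncurry_of_iteratedFDeriv_zero (hjc 0)
  have hc1 : ContinuousOn (fun p : ℝ × E => fderiv ℝ (u p.1) p.2) (J ×ˢ univ) :=
    continuousOn_fderiv_of_iteratedFDeriv_one (hjc 1)
  have hc2 : ContinuousOn (fun p : ℝ × E => (Δ (u p.1)) p.2) (J ×ˢ univ) :=
    continuousOn_laplacian_of_iteratedFDeriv_two (hjc 2)
  -- the right-hand side field, its truncation to the window, its regularity
  obtain ⟨h, hh⟩ : ∃ h : ℝ → E → E, h = fun τ y => ν • (Δ (u τ)) y - fderiv ℝ (u τ) y (u τ y) :=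
    ⟨_, rfl⟩
  have hhc : ContinuousOn (uncurry h) (J ×ˢ univ) := by
    have happ : ContinuousOn (fun p : ℝ × E => fderiv ℝ (u p.1) p.2 (u p.1 p.2)) (J ×ˢ univ) :=
      (isBoundedBilinearMap_apply (𝕜 := ℝ) (E := E) (F := E)).continuous.comp_continuousOn
        (hc1.prodMk hc0)
    rw [hh]
    exact (hc2.const_smul ν).sub happ
  have hhs : ∀ τ ∈ J, ContDiff ℝ ∞ (h τ) := fun τ hτ => by
    rw [hh]
    exact ((contDiff_laplacian_of_contDiff_infty (hsm τ hτ)).const_smul ν).sub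
      (((hsm τ hτ).fderiv_right (m := ∞) (by exact_mod_cast le_rfl)).clm_apply (hsm τ hτ))
  -- sup bounds of all `x`-derivatives of `h` on the window
  set K : ℕ → ℝ := fun k => |ν| * (Module.finrank ℝ E * C (k + 2)) +
    ∑ i ∈ Finset.range (k + 1), (k.choose i : ℝ) * C (i + 1) * C (k - i) with hK
  have hK0 : ∀ k, 0 ≤ K k := fun k => by
    have : 0 ≤ ∑ i ∈ Finset.range (k + 1), (k.choose i : ℝ) * C (i + 1) * C (k - i) :=
      Finset.sum_nonneg fun i _ => by
        have := hC0 (i + 1); have := hC0 (k - i); positivity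
    have := hC0 (k + 2)
    simp only [hK]
    positivity
  have hhb : ∀ k, ∀ τ ∈ J, ∀ y, ‖iteratedFDeriv ℝ k (h τ) y‖ ≤ K k := by
    intro k τ hτ y
    have hs2 := hsm τ hτ
    have e : h τ = (fun y => ν • (Δ (u τ)) y) - fun y => fderiv ℝ (u τ) y (u τ y) := by
      rw [hh]; rfl
    have hL : ContDiff ℝ ∞ fun y => ν • (Δ (u τ)) y := (contDiff_laplacian_of_contDiff_infty hs2).const_smul ν
    have hN : ContDiff ℝ ∞ fun y => fderiv ℝ (u τ) y (u τ y) :=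
      (hs2.fderiv_right (m := ∞) (by exact_mod_cast le_rfl)).clm_apply hs2
    rw [e, iteratedFDeriv_sub_apply (hL.contDiffAt.of_le (by exact_mod_cast le_top))
      (hN.contDiffAt.of_le (by exact_mod_cast le_top))]
    refine (norm_sub_le _ _).trans (add_le_add ?_ ?_)
    · rw [iteratedFDeriv_const_smul_apply' ((contDiff_laplacian_of_contDiff_infty hs2).contDiffAt.of_le
        (by exact_mod_cast le_top)), norm_smul, Real.norm_eq_abs]
      refine mul_le_mul_of_nonneg_left ?_ (abs_nonneg _)
      exact (norm_iteratedFDeriv_laplacian_le hs2 k y).trans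
        (mul_le_mul_of_nonneg_left (hC (k + 2) τ hτ y) (Nat.cast_nonneg _))
    · refine (norm_iteratedFDeriv_fderiv_apply_self_le hs2 k y).trans (Finset.sum_le_sum fun i _ => ?_)
      have := hC0 (i + 1)
      have h1 := hC (i + 1) τ hτ y
      have h2 := hC (k - i) τ hτ y
      have : (k.choose i : ℝ) * ‖iteratedFDeriv ℝ (i + 1) (u τ) y‖ ≤ (k.choose i : ℝ) * C (i + 1) :=
        mul_le_mul_of_nonneg_left h1 (Nat.cast_nonneg _)
      exact mul_le_mul this h2 (norm_nonneg _) (by positivity)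
  -- the truncated field `N = 1_J h`: smooth in `x` for every `τ`, jointly measurable
  set N : ℝ → E → E := J.piecewise h 0 with hNdef
  have hNJ : ∀ τ ∈ J, N τ = h τ := fun τ hτ => piecewise_eq_of_mem _ _ _ hτ
  have hNo : ∀ τ, τ ∉ J → N τ = 0 := fun τ hτ => piecewise_eq_of_notMem _ _ _ hτ
  have hNs : ∀ τ, ContDiff ℝ ∞ (N τ) := fun τ => by
    by_cases hτ : τ ∈ J
    · rw [hNJ τ hτ]; exact hhs τ hτ
    · rw [hNo τ hτ]; exact contDiff_const
  have hNm : StronglyMeasurable (uncurry N) := by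
    have he : uncurry N = (J ×ˢ (univ : Set E)).piecewise (uncurry h) 0 := by
      funext p
      by_cases hp : p.1 ∈ J
      · rw [piecewise_eq_of_mem _ _ _ (mk_mem_prod hp (mem_univ p.2))]
        simp only [uncurry, hNJ p.1 hp]
      · rw [piecewise_eq_of_notMem _ _ _ (fun hm => hp (mem_prod.1 hm).1)]
        simp only [uncurry, hNo p.1 hp, Pi.zero_apply]
    rw [he]
    exact (hhc.measurable_piecewise continuousOn_const (hJo.measurableSet.prod MeasurableSet.univ)).stronglyMeasurable
  have hNb : ∀ k τ y, ‖iteratedFDeriv ℝ k (N τ) y‖ ≤ K k := fun k τ y => by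
    by_cases hτ : τ ∈ J
    · rw [hNJ τ hτ]; exact hhb k τ hτ y
    · rw [hNo τ hτ]
      simp only [Pi.zero_def, iteratedFDeriv_fun_zero, Pi.zero_apply, norm_zero]
      exact hK0 k
  -- the time integral as a parametric integral over the finite measure `1_{(s,t]} dτ`
  set μ : Measure ℝ := (volume : Measure ℝ).restrict (Ioc s t) with hμ
  haveI : IsFiniteMeasure μ := ⟨by rw [hμ, Measure.restrict_apply_univ]; exact measure_Ioc_lt_top⟩
  have hPeq : (fun y => ∫ τ in s..t, (ν • (Δ (u τ)) y - fderiv ℝ (u τ) y (u τ y))) =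
      fun y => ∫ τ, N τ y ∂μ := by
    funext y
    rw [intervalIntegral.integral_of_le hst, hμ]
    refine setIntegral_congr_fun measurableSet_Ioc fun τ hτ => ?_
    have hτJ : τ ∈ J := hIJ (Ioc_subset_Icc_self hτ)
    rw [hNJ τ hτJ, hh]
  have hdom := fun m : ℕ => FunctionSpaces.contDiff_integral_of_dominated_iteratedFDeriv (μ := μ)
    hNm hNs (m := m) (bound := fun i _ => K i) (fun i _ => integrable_const _) (fun i _ τ y => hNb i τ y)
  have hPs : ContDiff ℝ ∞ fun y => ∫ τ, N τ y ∂μ := contDiff_infty.2 fun m => (hdom m).1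
  have hfiN : ∀ x, Integrable (fun τ => fderiv ℝ (N τ) x) μ := fun x => by
    have hm : AEStronglyMeasurable (fun τ => fderiv ℝ (N τ) x) μ :=
      ((FunctionSpaces.stronglyMeasurable_fderiv_param hNm fun τ y =>
        ((hNs τ).differentiable (by simp)) y).comp_measurable
        (measurable_id.prodMk measurable_const)).aestronglyMeasurable
    refine (integrable_const (K 1)).mono' hm (Eventually.of_forall fun τ => ?_)
    rw [← norm_iteratedFDeriv_one]
    exact hNb 1 τ x
  have hNh : ∀ x, (fun τ => fderiv ℝ (N τ) x) =ᵐ[μ]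
      fun τ => fderiv ℝ (fun y => ν • (Δ (u τ)) y - fderiv ℝ (u τ) y (u τ y)) x := fun x => by
    rw [hμ]
    filter_upwards [ae_restrict_mem measurableSet_Ioc] with τ hτ
    rw [hNJ τ (hIJ (Ioc_subset_Icc_self hτ)), hh]
  refine ⟨by rw [hPeq]; exact hPs, fun x => ?_, fun x => ?_⟩
  swap
  · -- interval integrability of the derivative of the integrand
    rw [intervalIntegrable_iff_integrableOn_Ioc_of_le hst, IntegrableOn, ← hμ]
    exact (hfiN x).congr (hNh x)
  -- the derivative formula, from the order-one clause of dominated differentiation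
  have h1 := (hdom 1).2 1 le_rfl x
  have hfi := hfiN x
  have hD : fderiv ℝ (fun y => ∫ τ, N τ y ∂μ) x = ∫ τ, fderiv ℝ (N τ) x ∂μ := by
    ext v
    have e1 : fderiv ℝ (fun y => ∫ τ, N τ y ∂μ) x v = iteratedFDeriv ℝ 1 (fun y => ∫ τ, N τ y ∂μ) x ![v] := by
      rw [iteratedFDeriv_one_apply]; rfl
    rw [e1, h1, ContinuousLinearMap.integral_apply hfi v]
    have hint1 : Integrable (fun τ => iteratedFDeriv ℝ 1 (N τ) x) μ :=
      (integrable_const (K 1)).mono'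
        (((FunctionSpaces.stronglyMeasurable_iteratedFDeriv_param hNm hNs 1).comp_measurable
          (measurable_id.prodMk measurable_const)).aestronglyMeasurable)
        (Eventually.of_forall fun τ => hNb 1 τ x)
    have hev := (ContinuousMultilinearMap.apply ℝ (fun _ : Fin 1 => E) E ![v]).integral_comp_comm hint1
    simp only [ContinuousMultilinearMap.apply_apply] at hev
    rw [← hev]
    refine integral_congr_ae (Eventually.of_forall fun τ => ?_)
    beta_reduce
    rw [iteratedFDeriv_one_apply]
    rfl
  rw [hPeq, hD, intervalIntegral.integral_of_le hst, ← hμ]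
  exact integral_congr_ae (hNh x)

end Rhs

/-! ### The increment minus the time-integrated right-hand side is curl free -/

section Main

variable {a T ν : ℝ} {u : ℝ → E → E}

/-- **Bounded weak solutions with smooth slices: `u(t) − u(s) − ∫ₛᵗ(νΔu − Du[u])` is curl free.**
Let `u` be a bounded weak Navier–Stokes solution on `(a, T) × E` (solenoidal space–time tests)
whose slices are `C^∞` with `‖Dᵏu(t, x)‖ ≤ C_k` on the window and `(t, x) ↦ Dᵏu(t)(x)` jointly
continuous on `(a, T) × E` for every `k`. Then for `a < s ≤ t < T` the field
`g = u(t) − u(s) − ∫ₛᵗ (νΔu(τ) − Du(τ)[u(τ)]) dτ` is smooth with symmetric derivative,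
`⟪Dg(x)v, w⟫ = ⟪Dg(x)w, v⟫` (KNSS 2009, §4: the equation holds modulo a gradient in the sense of
distributions; de Rham). [cite: KochNadirashviliSereginSverak2009, §4 p. 8 ((ii), (4.8)) (arXiv:0709.3599v1)] -/
theorem IsBoundedWeakNSSolutionOn.inner_fderiv_increment_comm
    (hu : IsBoundedWeakNSSolutionOn (Ioo a T) isOpen_Ioo ν u)
    (hsm : ∀ t ∈ Ioo a T, ContDiff ℝ ∞ (u t))
    (hbd : ∀ k : ℕ, ∃ C : ℝ, ∀ t ∈ Ioo a T, ∀ x, ‖iteratedFDeriv ℝ k (u t) x‖ ≤ C)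
    (hjc : ∀ k : ℕ, ContinuousOn (fun p : ℝ × E => iteratedFDeriv ℝ k (u p.1) p.2) (Ioo a T ×ˢ univ))
    {s t : ℝ} (hs : a < s) (hst : s ≤ t) (ht : t < T) (x v w : E) :
    ⟪fderiv ℝ (fun y => u t y - u s y -
        ∫ τ in s..t, (ν • (Δ (u τ)) y - fderiv ℝ (u τ) y (u τ y))) x v, w⟫ =
      ⟪fderiv ℝ (fun y => u t y - u s y -
        ∫ τ in s..t, (ν • (Δ (u τ)) y - fderiv ℝ (u τ) y (u τ y))) x w, v⟫ := by
  set J : Set ℝ := Ioo a T with hJ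
  have hsJ : s ∈ J := ⟨hs, hst.trans_lt ht⟩
  have htJ : t ∈ J := ⟨hs.trans_le hst, ht⟩
  choose C hC using hbd
  have hC0 : ∀ k, 0 ≤ C k := fun k => (norm_nonneg _).trans (hC k s hsJ 0)
  -- hypotheses of the orthogonality theorem
  have hM : ∀ τ ∈ J, ∀ y, ‖u τ y‖ ≤ C 0 := fun τ hτ y => by
    simpa [norm_iteratedFDeriv_zero] using hC 0 τ hτ y
  have hB1 : ∀ τ ∈ J, ∀ y, ‖fderiv ℝ (u τ) y‖ ≤ C 1 + Module.finrank ℝ E * C 2 + C 2 := fun τ hτ y => by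
    have h1 := hC 1 τ hτ y
    rw [norm_iteratedFDeriv_one] at h1
    nlinarith [hC0 2, (Nat.cast_nonneg (Module.finrank ℝ E) : (0:ℝ) ≤ _)]
  have hB2 : ∀ τ ∈ J, ∀ y, ‖(Δ (u τ)) y‖ ≤ C 1 + Module.finrank ℝ E * C 2 + C 2 := fun τ hτ y => by
    have h2 := norm_iteratedFDeriv_laplacian_le (hsm τ hτ) 0 y
    rw [norm_iteratedFDeriv_zero] at h2
    have h3 : (Module.finrank ℝ E : ℝ) * ‖iteratedFDeriv ℝ 2 (u τ) y‖ ≤ Module.finrank ℝ E * C 2 :=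
      mul_le_mul_of_nonneg_left (hC 2 τ hτ y) (Nat.cast_nonneg _)
    linarith [hC0 1, hC0 2]
  have hc0 : ContinuousOn (uncurry u) (J ×ˢ univ) := continuousOn_uncurry_of_iteratedFDeriv_zero (hjc 0)
  have hc1 : ContinuousOn (fun p : ℝ × E => fderiv ℝ (u p.1) p.2) (J ×ˢ univ) :=
    continuousOn_fderiv_of_iteratedFDeriv_one (hjc 1)
  have hc2 : ContinuousOn (fun p : ℝ × E => (Δ (u p.1)) p.2) (J ×ˢ univ) :=
    continuousOn_laplacian_of_iteratedFDeriv_two (hjc 2)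
  have horth := fun (φ : E → E) (hφ : FunctionSpaces.IsTestFunctionOn (⊤ : Opens E) φ)
      (hdiv : VectorCalculus.IsDivFree φ) =>
    hu.integral_inner_sub_sub_integral_eq_zero hM (fun τ hτ => contDiff_infty.1 (hsm τ hτ) 2)
      hB1 hB2 hc0 hc1 hc2 hs hst ht hφ hdiv
  obtain ⟨hPs, -, -⟩ := contDiff_integral_rhs_and_fderiv (ν := ν) hsm (fun k => ⟨C k, hC k⟩) hjc hs hst ht
  have hg : ContDiff ℝ ∞ fun y => u t y - u s y -
      ∫ τ in s..t, (ν • (Δ (u τ)) y - fderiv ℝ (u τ) y (u τ y)) :=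
    ((hsm t htJ).sub (hsm s hsJ)).sub hPs
  exact inner_fderiv_comm_of_forall_integral_inner_eq_zero hg horth x v w

end Main

end Literature.Analysis.FluidPDE

end


/-!
# KNSS 2009, (4.8) in time-integrated form for bounded weak solutions with smooth slices (`n = 3`)

Analysis/FluidPDE proofs file (Koch–Nadirashvili–Seregin–Šverák, Acta Math. 203 (2009) =
arXiv:0709.3599v1, §4 p. 8: "For `n = 3` the equation for `ω` is
(4.8) `ω_{i,t} − Δω_i = ∂_j(ω_j u_i − ω_i u_j)` and it is easy to check that in our situation this
equation is satisfied in the sense of distributions"). For a bounded weak Navier–Stokes solution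
`u` on `(a, T) × ℝ³` (solenoidal space–time tests, viscosity `ν`) with `C^∞` slices, all
`x`-derivatives bounded on the window and jointly continuous in `(t, x)`:

  `curl u(t, x) − curl u(s, x) = ∫ₛᵗ (νΔω − Dω[u] + Du[ω])(τ, x) dτ`,  `ω = curl u(τ)`,

for all `x` and `a < s ≤ t < T` (`IsBoundedWeakNSSolutionOn.curl_sub_curl_eq_integral`; the
`ν = 1` rendering `…_one` is literally the vorticity clause of the tree's
`KNSS2009_mild_regularity` / `KNSS2009_regularity_boundedWeak_window`). Proof: the increment
`u(t) − u(s) − ∫ₛᵗ(νΔu − Du[u])` is curl free (`WeakSolutionIncrementCurlFree`, de Rham), the curl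
passes under the time integral (the derivative does, `contDiff_integral_rhs_and_fderiv`), and at
a.e. `τ` (where the slice is divergence free) `curl(νΔu − Du[u]) = νΔω − (u·∇)ω + (ω·∇)u`
(`curl_laplacian`, `curl_convect_self_of_isDivFree`). No time derivative of `u` is used.

## References

* G. Koch, N. Nadirashvili, G. Seregin, V. Šverák, Acta Math. 203 (2009) = arXiv:0709.3599v1,
  §4 p. 8, (4.8)–(4.11). [KochNadirashviliSereginSverak2009]
-/

noncomputable section

open MeasureTheory TopologicalSpace Set Function Filter Metric InnerProductSpace intervalIntegral
open _root_.Topology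
open scoped ENNReal NNReal Laplacian RealInnerProductSpace ContDiff

namespace Literature.Analysis.FluidPDE

section Three

variable {a T ν : ℝ} {u : ℝ → EuclideanSpace ℝ (Fin 3) → EuclideanSpace ℝ (Fin 3)}

/-- **(4.8), time-integrated, for bounded weak solutions with smooth slices on `ℝ³`**: under the
hypotheses of `IsBoundedWeakNSSolutionOn.inner_fderiv_increment_comm` (`C^∞` slices, bounded
`x`-derivatives, joint continuity of every `Dᵏu` on `(a, T) × ℝ³`), for `a < s ≤ t < T` and all `x`,
`curl u(t)(x) − curl u(s)(x) = ∫ₛᵗ (νΔ(curl u(τ))(x) − D(curl u(τ))(x)[u(τ,x)] + Du(τ)(x)[curl u(τ)(x)]) dτ`.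
[cite: KochNadirashviliSereginSverak2009, §4 (4.8) (arXiv:0709.3599v1 p. 8)] -/
theorem IsBoundedWeakNSSolutionOn.curl_sub_curl_eq_integral
    (hu : IsBoundedWeakNSSolutionOn (Ioo a T) isOpen_Ioo ν u)
    (hsm : ∀ t ∈ Ioo a T, ContDiff ℝ ∞ (u t))
    (hbd : ∀ k : ℕ, ∃ C : ℝ, ∀ t ∈ Ioo a T, ∀ x, ‖iteratedFDeriv ℝ k (u t) x‖ ≤ C)
    (hjc : ∀ k : ℕ, ContinuousOn
      (fun p : ℝ × EuclideanSpace ℝ (Fin 3) => iteratedFDeriv ℝ k (u p.1) p.2) (Ioo a T ×ˢ univ))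
    {s t : ℝ} (hs : a < s) (hst : s ≤ t) (ht : t < T) (x : EuclideanSpace ℝ (Fin 3)) :
    curl (u t) x - curl (u s) x =
      ∫ τ in s..t, (ν • (Δ (curl (u τ))) x - fderiv ℝ (curl (u τ)) x (u τ x) +
        fderiv ℝ (u τ) x (curl (u τ) x)) := by
  set J : Set ℝ := Ioo a T with hJ
  have hsJ : s ∈ J := ⟨hs, hst.trans_lt ht⟩
  have htJ : t ∈ J := ⟨hs.trans_le hst, ht⟩
  have hIJ : Icc s t ⊆ J := fun τ hτ => ⟨hs.trans_le hτ.1, hτ.2.trans_lt ht⟩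
  -- the time-integrated right-hand side `P` and the increment `g = u t − u s − P`
  obtain ⟨hPs, hPD, hPi⟩ := contDiff_integral_rhs_and_fderiv (ν := ν) hsm hbd hjc hs hst ht
  have hsymm := hu.inner_fderiv_increment_comm hsm hbd hjc hs hst ht
  obtain ⟨P, hP⟩ : ∃ P : EuclideanSpace ℝ (Fin 3) → EuclideanSpace ℝ (Fin 3),
      P = fun y => ∫ τ in s..t, (ν • (Δ (u τ)) y - fderiv ℝ (u τ) y (u τ y)) := ⟨_, rfl⟩
  have hPs' : ContDiff ℝ ∞ P := by rw [hP]; exact hPs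
  have hPD' : fderiv ℝ P x =
      ∫ τ in s..t, fderiv ℝ (fun y => ν • (Δ (u τ)) y - fderiv ℝ (u τ) y (u τ y)) x := by
    rw [hP]; exact hPD x
  -- `curl g = 0`
  have hcurl0 : curl (fun y => u t y - u s y - P y) x = 0 := by
    have h := curl_eq_zero_of_inner_fderiv_comm (hsymm x)
    have e : (fun y => u t y - u s y - P y) =
        fun y => u t y - u s y - ∫ τ in s..t, (ν • (Δ (u τ)) y - fderiv ℝ (u τ) y (u τ y)) := by
      rw [hP]
    rw [e]
    exact h
  have hdt : DifferentiableAt ℝ (u t) x := ((hsm t htJ).differentiable (by simp)) x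
  have hds : DifferentiableAt ℝ (u s) x := ((hsm s hsJ).differentiable (by simp)) x
  have hdP : DifferentiableAt ℝ P x := (hPs'.differentiable (by simp)) x
  have e1 : curl (fun y => u t y - u s y - P y) x = curl (fun y => u t y - u s y) x - curl P x :=
    curl_sub (f := fun y => u t y - u s y) (g := P) (hdt.sub hds) hdP
  have e2 : curl (fun y => u t y - u s y) x = curl (u t) x - curl (u s) x := curl_sub hdt hds
  rw [e1, e2, sub_eq_zero] at hcurl0
  rw [hcurl0, curl_eq_curlCLM, hPD']
  -- the curl under the time integral
  have hslice : ∀ τ ∈ J, ContDiff ℝ ∞ fun y => ν • (Δ (u τ)) y - fderiv ℝ (u τ) y (u τ y) := fun τ hτ =>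
    ((contDiff_laplacian_of_contDiff_infty (hsm τ hτ)).const_smul ν).sub
      (((hsm τ hτ).fderiv_right (m := ∞) (by exact_mod_cast le_rfl)).clm_apply (hsm τ hτ))
  rw [← curlCLM.intervalIntegral_comp_comm (hPi x)]
  refine intervalIntegral.integral_congr_ae ?_
  -- at a.e. `τ` the slice is divergence free
  have hae : ∀ᵐ τ ∂(volume : Measure ℝ), τ ∈ uIoc s t → VectorCalculus.IsDivFree (u τ) := by
    have h1 := hu.2.2.1
    rw [ae_restrict_iff' measurableSet_Ioo] at h1
    filter_upwards [h1] with τ hτ hτI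
    have hτJ : τ ∈ J := hIJ (by rw [uIoc_of_le hst] at hτI; exact Ioc_subset_Icc_self hτI)
    exact (hτ hτJ).isDivFree_of_contDiff (contDiff_infty.1 (hsm τ hτJ) 1)
  filter_upwards [hae] with τ hdivτ hτI
  have hdiv := hdivτ hτI
  have hτJ : τ ∈ J := hIJ (by rw [uIoc_of_le hst] at hτI; exact Ioc_subset_Icc_self hτI)
  have hsmτ := hsm τ hτJ
  -- `curl (νΔu − Du[u]) = νΔω − Dω[u] + Du[ω]`
  have hdΔ : DifferentiableAt ℝ (fun y => ν • (Δ (u τ)) y) x :=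
    (((contDiff_laplacian_of_contDiff_infty hsmτ).const_smul ν).differentiable (by simp)) x
  have hdC : DifferentiableAt ℝ (fun y => fderiv ℝ (u τ) y (u τ y)) x :=
    (((hsmτ.fderiv_right (m := ∞) (by exact_mod_cast le_rfl)).clm_apply hsmτ).differentiable (by simp)) x
  rw [← curl_eq_curlCLM, curl_sub hdΔ hdC,
    curl_const_smul (((contDiff_laplacian_of_contDiff_infty hsmτ).differentiable (by simp)) x),
    curl_laplacian (contDiff_infty.1 hsmτ 3)]
  have hconv : (fun y => fderiv ℝ (u τ) y (u τ y)) = convect (u τ) (u τ) := by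
    funext y; rfl
  rw [hconv, curl_convect_self_of_isDivFree (contDiff_infty.1 hsmτ 2) hdiv]
  simp only [convect_apply]
  abel

/-- **(4.8), time-integrated, `ν = 1`**: the vorticity clause of the tree's
`KNSS2009_mild_regularity` / `KNSS2009_regularity_boundedWeak_window`, for bounded weak solutions
with smooth slices on a window `(a, T)` (take `a = 0`). [cite: KochNadirashviliSereginSverak2009, §4 (4.8) (arXiv:0709.3599v1 p. 8)] -/
theorem IsBoundedWeakNSSolutionOn.curl_sub_curl_eq_integral_one
    (hu : IsBoundedWeakNSSolutionOn (Ioo a T) isOpen_Ioo 1 u)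
    (hsm : ∀ t ∈ Ioo a T, ContDiff ℝ ∞ (u t))
    (hbd : ∀ k : ℕ, ∃ C : ℝ, ∀ t ∈ Ioo a T, ∀ x, ‖iteratedFDeriv ℝ k (u t) x‖ ≤ C)
    (hjc : ∀ k : ℕ, ContinuousOn
      (fun p : ℝ × EuclideanSpace ℝ (Fin 3) => iteratedFDeriv ℝ k (u p.1) p.2) (Ioo a T ×ˢ univ))
    (x : EuclideanSpace ℝ (Fin 3)) {s t : ℝ} (hs : a < s) (hst : s ≤ t) (ht : t < T) :
    curl (u t) x - curl (u s) x =
      ∫ τ in s..t, ((Δ (curl (u τ))) x - fderiv ℝ (curl (u τ)) x (u τ x) +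
        fderiv ℝ (u τ) x (curl (u τ) x)) := by
  rw [hu.curl_sub_curl_eq_integral hsm hbd hjc hs hst ht x]
  exact intervalIntegral.integral_congr fun τ _ => by simp only [one_smul]

end Three

end Literature.Analysis.FluidPDE

end


/-!
# KNSS 2009, §4: regularity of bounded mild solutions — discharge, and Theorems 5.1 ("§4") closed

Analysis/FluidPDE proofs file discharging the named fact
`Literature.Analysis.FluidPDE.KNSS2009_mild_regularity` (`KNSSRegularityGalilean.lean`;
Koch–Nadirashvili–Seregin–Šverák, Acta Math. 203 (2009) = arXiv:0709.3599v1, §4: Proposition 4.1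
with (4.6) and the closing paragraph (4.8)–(4.11) for bounded mild solutions on `ℝ³`), and with
it the chain of the tree:

* `KNSS2009_mild_regularity_holds` — assembled from the tree's a priori bootstrap
  (`KNSSBootstrap.level_all`: `C^∞` slices and the uniform bounds (4.10);
  `KNSSBootstrap.exists_lipschitz_time_iteratedFDeriv`: (4.11);
  `KNSSBootstrap.continuousOn_uncurry_iteratedFDeriv`: joint continuity of every `Dᵏ`), the
  divergence constraint at **every** time (a.e. weak divergence-freeness, smooth slices, and
  continuity in time of `div V(t)(x)`), and the vorticity clause (4.8) in time-integrated form
  from `IsBoundedWeakNSSolutionOn.curl_sub_curl_eq_integral_one` (`WeakSolutionVorticityIdentity`: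
  bounded mild solutions are bounded weak solutions, `isBoundedWeakNSSolutionOn_of_mem_Ioo`, and
  for weak solutions with smooth, bounded, jointly continuous `x`-derivatives the increment
  `u(t) − u(s) − ∫ₛᵗ(Δu − Du[u])` is curl free — no joint smoothness in `(t, x)` is needed);
* `KNSS2009_regularity_boundedWeak_ancient_holds` (`…_of_mild_regularity`,
  `KNSSRegularityWindowOfProp41`), `KNSS2009_regularity_boundedWeak_ancient_planar_holds`
  (`…_of_ancient`, `KNSSRegularityPlanarOfSpace`), and **Theorem 5.1**
  `KNSS2009_liouville_planar_holds` (`KNSS2009_liouville_planar_of_ancient`).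

## References

* G. Koch, N. Nadirashvili, G. Seregin, V. Šverák, Acta Math. 203 (2009) = arXiv:0709.3599v1,
  §4 p. 8 (Prop. 4.1, (4.6), (4.8)–(4.11)), §5 Theorem 5.1 p. 9. [KochNadirashviliSereginSverak2009]
-/

noncomputable section

open MeasureTheory TopologicalSpace Set Function Filter Metric InnerProductSpace
open _root_.Topology
open scoped ENNReal NNReal Laplacian RealInnerProductSpace ContDiff

namespace Literature.Analysis.FluidPDE

/-- **Divergence-freeness at every time of a restarted-mild field**: the slices are smooth, weakly
divergence free at a.e. time (hence divergence free there), and `t ↦ div V(t)(x)` is continuous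
on `(0, T)` (the Lipschitz bound (4.11) for `DV`), so `div V(t) = 0` for every `t ∈ (0, T)`.
[folklore] -/
theorem IsKNSSDriftMild.isDivFree_of_mem_Ioo {T N : ℝ}
    {V : ℝ → EuclideanSpace ℝ (Fin 3) → EuclideanSpace ℝ (Fin 3)} (hV : IsKNSSDriftMild T N V 0)
    {t : ℝ} (ht : t ∈ Ioo 0 T) : VectorCalculus.IsDivFree (V t) := by
  have hE : Module.finrank ℝ (EuclideanSpace ℝ (Fin 3)) = 3 := by simp
  intro x
  -- `τ ↦ div V(τ)(x)` is continuous on `(0, T)`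
  set f : ℝ → ℝ := fun τ => VectorCalculus.divergence (V τ) x with hf
  have h1 : ContinuousOn (fun τ => iteratedFDeriv ℝ 1 (V τ) x) (Ioo 0 T) :=
    KNSSBootstrap.continuousOn_time_iteratedFDeriv hE hV 1 x
  have hD : ContinuousOn (fun τ => fderiv ℝ (V τ) x) (Ioo 0 T) := by
    have he : (fun τ => fderiv ℝ (V τ) x) = fun τ =>
        (continuousMultilinearCurryFin1 ℝ (EuclideanSpace ℝ (Fin 3)) (EuclideanSpace ℝ (Fin 3)))
          (iteratedFDeriv ℝ 1 (V τ) x) := by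
      funext τ; ext v; simp
    rw [he]
    exact (continuousMultilinearCurryFin1 ℝ _ _).continuous.comp_continuousOn h1
  have htr : Continuous fun A : EuclideanSpace ℝ (Fin 3) →L[ℝ] EuclideanSpace ℝ (Fin 3) =>
      LinearMap.trace ℝ _ (A : EuclideanSpace ℝ (Fin 3) →ₗ[ℝ] EuclideanSpace ℝ (Fin 3)) :=
    ((LinearMap.trace ℝ (EuclideanSpace ℝ (Fin 3))).comp
      (ContinuousLinearMap.coeLM ℝ)).continuous_of_finiteDimensional
  have hfc : ContinuousOn f (Ioo 0 T) := htr.comp_continuousOn hD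
  -- `f = 0` at a.e. time
  have hae : ∀ᵐ τ ∂((volume : Measure ℝ).restrict (Ioo 0 T)), f τ = 0 := by
    filter_upwards [hV.ae_isWeaklyDivFree, ae_restrict_mem measurableSet_Ioo] with τ hτ hτI
    exact (hτ.isDivFree_of_contDiff (contDiff_infty.1 (KNSSBootstrap.contDiff_slice hE hV hτI) 1)) x
  have hEq : EqOn f (fun _ => (0 : ℝ)) (Ioo 0 T) :=
    Measure.eqOn_open_of_ae_eq hae isOpen_Ioo hfc continuousOn_const
  exact hEq ht

/-- **KNSS 2009, §4 for bounded mild solutions (`KNSS2009_mild_regularity`), PROVED.**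
[cite: KochNadirashviliSereginSverak2009, Prop. 4.1 with (4.6) and §4 (4.8)–(4.11) (arXiv:0709.3599v1 p. 8)] -/
theorem KNSS2009_mild_regularity_holds : KNSS2009_mild_regularity := by
  intro N T hT
  have hE : Module.finrank ℝ (EuclideanSpace ℝ (Fin 3)) = 3 := by simp
  -- the constants, uniform in the solution
  have hlev := fun k : ℕ => KNSSBootstrap.level_all hE (E := EuclideanSpace ℝ (Fin 3)) (T := T) (N := N) k
  choose C hC0 hCV using hlev
  have hlip : ∀ (k : ℕ) (δ : ℝ), ∃ L : ℝ, 0 < δ → 0 ≤ L ∧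
      ∀ ⦃V : ℝ → EuclideanSpace ℝ (Fin 3) → EuclideanSpace ℝ (Fin 3)⦄, IsKNSSDriftMild T N V 0 →
        ∀ s ∈ Ico δ T, ∀ t ∈ Ico δ T, ∀ x,
          ‖iteratedFDeriv ℝ k (V t) x - iteratedFDeriv ℝ k (V s) x‖ ≤ L * |t - s| := by
    intro k δ
    by_cases hδ : 0 < δ
    · obtain ⟨L, hL0, hL⟩ :=
        KNSSBootstrap.exists_lipschitz_time_iteratedFDeriv hE (E := EuclideanSpace ℝ (Fin 3))
          (T := T) (N := N) k hδ
      exact ⟨L, fun _ => ⟨hL0, hL⟩⟩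
    · exact ⟨0, fun h => absurd h hδ⟩
  choose L hL using hlip
  refine ⟨C, L, fun V hV => ⟨fun t ht => KNSSBootstrap.contDiff_slice hE hV ht,
    fun t ht => hV.isDivFree_of_mem_Ioo ht,
    fun δ hδ k t ht x => (hCV k hV).2.1 δ hδ k le_rfl t ⟨ht.1.le, ht.2⟩ x,
    fun δ hδ k s hs t ht x => (hL k δ hδ).2 hV s ⟨hs.1.le, hs.2⟩ t ⟨ht.1.le, ht.2⟩ x,
    fun x s t hs hst htT => ?_⟩⟩
  -- the vorticity clause on the window `(s/2, T)`
  have hs2 : 0 < s / 2 := half_pos hs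
  have hs2T : s / 2 ∈ Ioo 0 T := ⟨hs2, by linarith [hst, htT]⟩
  have hu := hV.isBoundedWeakNSSolutionOn_of_mem_Ioo hE hs2T
  have hsub : Ioo (s / 2) T ⊆ Ioo 0 T := Ioo_subset_Ioo_left hs2.le
  refine hu.curl_sub_curl_eq_integral_one (fun τ hτ => KNSSBootstrap.contDiff_slice hE hV (hsub hτ))
    (fun k => ⟨C k (s / 2), fun τ hτ y => (hCV k hV).2.1 (s / 2) hs2 k le_rfl τ ⟨hτ.1.le, hτ.2⟩ y⟩)
    (fun k => (KNSSBootstrap.continuousOn_uncurry_iteratedFDeriv hE hV k).mono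
      (prod_mono hsub Subset.rfl)) x (by linarith) hst htT

/-- **KNSS 2009, §4 on `ℝ³ × (−∞, 0)` (`KNSS2009_regularity_boundedWeak_ancient`), PROVED.**
[cite: KochNadirashviliSereginSverak2009, §4 p. 8 with §5 proof of Thm 5.2, first sentence (arXiv:0709.3599v1 p. 10)] -/
theorem KNSS2009_regularity_boundedWeak_ancient_holds : KNSS2009_regularity_boundedWeak_ancient :=
  KNSS2009_regularity_boundedWeak_ancient_of_mild_regularity KNSS2009_mild_regularity_holds

/-- **KNSS 2009, §4 on `ℝ² × (−∞, 0)` (`KNSS2009_regularity_boundedWeak_ancient_planar`), PROVED.**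
[cite: KochNadirashviliSereginSverak2009, §4 p. 8 with §5 proof of Thm 5.1 (arXiv:0709.3599v1 p. 9)] -/
theorem KNSS2009_regularity_boundedWeak_ancient_planar_holds :
    KNSS2009_regularity_boundedWeak_ancient_planar :=
  KNSS2009_regularity_boundedWeak_ancient_planar_of_ancient KNSS2009_regularity_boundedWeak_ancient_holds

/-- **KNSS 2009, Theorem 5.1 (Liouville theorem for bounded weak solutions in `ℝ² × (−∞, 0)`),
PROVED**: `KNSS2009_liouville_planar` (`KNSSLiouville.lean`) through the tree's reduction to §4
(`KNSS2009_liouville_planar_of_ancient`). [cite: KochNadirashviliSereginSverak2009, Thm 5.1 (arXiv:0709.3599v1 p. 9)] -/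
theorem KNSS2009_liouville_planar_holds : KNSS2009_liouville_planar :=
  KNSS2009_liouville_planar_of_ancient KNSS2009_regularity_boundedWeak_ancient_holds

end Literature.Analysis.FluidPDE

end
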